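import Mathlib
import Summits.CriticalPhenomena.Ising3DConformalLimit.Theses.MarkovRigidity
import Summits.CriticalPhenomena.Ising3DConformalLimit.Theorems.MarkovRigidityFieldRealisationCharFunctional
import Summits.CriticalPhenomena.Ising3DConformalLimit.Theorems.MarkovRigidityFieldRealisationMomentsOfLimit
import Summits.CriticalPhenomena.Ising3DConformalLimit.Theorems.MarkovRigidityFieldRealisationClusterLimit
import Summits.CriticalPhenomena.Ising3DConformalLimit.Theorems.MarkovRigidityFieldRealisationInvariances
import Summits.CriticalPhenomena.Ising3DConformalLimit.Theorems.MarkovRigidityFieldRealisationLatticeRP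
import Summits.CriticalPhenomena.Ising3DConformalLimit.Theorems.RotationUpgradeFromTwoPoint.Negative.ContinuityFree
import Literature.Probability.LatticeModels.PlusMinusStateGibbs
import HarnessLib

/-!
# Route MarkovRigidity, support item `FieldRealisation` (stmt-CriticalPhenomena-11245): proof

`FieldRealisation` (the route decl, verbatim): every pointwise scaling limit `S` of the critical
`ℤ³` Ising correlators under a renormalisation `ρ > 0` on `(0,1]`, normalised to `0` off the
non-coincident configurations, with non-degenerate two-point function, translation invariant and
scale covariant with dimension `Δ`, (a) is continuous on the non-coincident configurations, and
(b) is the family of moment densities of a probability law `μ` on `𝒮'(ℝ³)` with all moments and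
exponential moments, translation invariant, scale covariant with dimension `Δ`, invariant under the
time reflection, OS-reflection positive and OS4 time-clustering.

Proof.  (a) is the tree theorem `continuousOn_of_limit` (continuity of any limit is automatic).
(b): `Δ ∈ [1/2, 1]` (`HyperoctahedralRPTwoPoint.window`); smear the spins under the plus DLR state
`ν` at `β_c` (`exists_plusMeasure_holds`) over the boxes `box 3 ⌊δ⁻²⌋`, `Φ_δ(f) = ρ(δ)δ³Σf(δx)σ_x`;
the generating functionals of these laws converge (moments converge by dominated convergence with the
mesh-uniform kernel bound and Newman's Gaussian domination, Tannery) to a characteristic functional,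
whose Minlos measure `μ` (`exists_limitLaw`) has all moments, exponential moments and moment
densities `S` (`MarkovRigidityFieldRealisationMomentsOfLimit`), is translation invariant, scale
covariant and `θ`-invariant (`…Invariances`), reflection positive (limit of the lattice OS3
inequality `genFunctional_spinFieldLaw_reflectionPositive`, this file) and time-clustering
(`tendsto_genFunctional_timeShift`, this file: from the limit covariance bound, translation
invariance, the decay `S₂ ≤ M‖x₁−x₀‖^{-2Δ}`, the kernel bound `S₂ ≤ C max(1,‖x₁−x₀‖^{-a})` and the
Schwartz decay of `f, g`, splitting `‖x₁−x₀‖ ≷ t/2`).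

References: Glimm–Jaffe 1987 §6.1; Fröhlich–Israel–Lieb–Simon 1978; Newman 1975, 1980;
Gel'fand–Vilenkin IV §4.  No definitions are introduced.
-/

noncomputable section

namespace Summit.CriticalPhenomena.Ising3DConformalLimit.MarkovRigidityFieldRealisation

open MeasureTheory Filter Complex Literature.Probability.LatticeModels
  Literature.MathematicalPhysics.QuantumLattice
open Summit.CriticalPhenomena.Ising3DConformalLimit
open Summit.CriticalPhenomena.Ising3DConformalLimit.Theses.MarkovRigidity
open scoped Topology Nat ENNReal ComplexConjugate

variable {ρ : ℝ → ℝ} {Δ : ℝ} {S : CorrFamily 3}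
variable {ν : Measure (SpinConfig (Site 3))} [IsProbabilityMeasure ν]
variable {L : ℝ → ℕ}
variable {μ : Measure (FieldConfig (EuclideanSpace ℝ (Fin 3)))} [IsProbabilityMeasure μ]

/-! ### OS4: time clustering of the continuum law -/

/-- **OS4 — time clustering**: for the continuum law `μ` (limit in law of the smeared critical
fields, with generating functional the moment series of `S`), `S_μ(f + T_t g) → S_μ(f) S_μ(g)` as
`t → ∞`. [cite: GlimmJaffe1987, §6.1] -/
theorem tendsto_genFunctional_timeShift (hlim : HasPointwiseScalingLimit (criticalCorr 3) ρ S)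
    (hnd : IsNondegenerateTwoPoint S) (hsc : IsScaleCovariant Δ S) (htr : IsTranslationInvariant S)
    (hΔ0 : 0 < Δ) (hΔ : Δ < 3 / 2)
    (hν : ∀ A : Finset (Site 3), spinCorr ν A = plusCorr 3 (criticalBeta 3) 0 A)
    (hL : Tendsto (fun δ => δ * L δ) (𝓝[>] 0) atTop)
    (hlaw : TendstoInLaw (fun δ => spinFieldLaw ν (box 3 (L δ)) δ (ρ δ)) (𝓝[>] 0) μ)
    (hμC : ∀ f : SchwartzMap (EuclideanSpace ℝ (Fin 3)) ℝ, genFunctional μ f =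
      ∑' n : ℕ, I ^ n * ((∫ x : Fin n → EuclideanSpace ℝ (Fin 3),
        (∏ i, f (x i)) * S n x : ℝ) : ℂ) / n !)
    (f g : SchwartzMap (EuclideanSpace ℝ (Fin 3)) ℝ) :
    Tendsto (fun t : ℝ => genFunctional μ (f + timeShiftTest 3 t g)) atTop
      (𝓝 (genFunctional μ f * genFunctional μ g)) := by
  obtain ⟨M, hM0, hM⟩ := limit_two_le_rpow hlim hsc htr
  obtain ⟨a, C, ha0, ha3, hC0, hK⟩ := limit_two_le_kernel hlim hnd hsc hΔ0 hΔ
  -- translation invariance: `S_μ(T_t g) = S_μ(g)`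
  have htinv : IsTranslationInvariantLaw μ := isTranslationInvariantLaw_of hμC htr
  have htrans : ∀ t : ℝ, genFunctional μ (timeShiftTest 3 t g) = genFunctional μ g := by
    intro t
    have h := genFunctional_map_act (μ := μ) (translateTest (-(-EuclideanSpace.single (0 : Fin 3) t))) g
    have hmap : μ.map (FieldConfig.act (translateTest (-(-EuclideanSpace.single (0 : Fin 3) t)))) = μ :=
      htinv (-EuclideanSpace.single (0 : Fin 3) t)
    rw [hmap, neg_neg] at h
    exact h.symm
  -- weights and constants
  set Bf : ℝ := 2 ^ 5 * ((Finset.Iic ((5, 0) : ℕ × ℕ)).sup (schwartzSeminormFamily ℝ (EuclideanSpace ℝ (Fin 3)) ℝ)) f with hBf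
  set Bg : ℝ := 2 ^ 5 * ((Finset.Iic ((5, 0) : ℕ × ℕ)).sup (schwartzSeminormFamily ℝ (EuclideanSpace ℝ (Fin 3)) ℝ)) g with hBg
  have hBf0 : 0 ≤ Bf := by positivity
  have hBg0 : 0 ≤ Bg := by positivity
  set w : EuclideanSpace ℝ (Fin 3) → ℝ := fun p => (1 + ‖p‖) ^ (-(4 : ℝ)) with hw
  set J₀ : ℝ := (∫ p : EuclideanSpace ℝ (Fin 3), w p) ^ 2 + (∫ p : EuclideanSpace ℝ (Fin 3), w p) *
    ∫ v : EuclideanSpace ℝ (Fin 3), (Metric.ball (0 : EuclideanSpace ℝ (Fin 3)) 1).indicator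
      (fun v => ‖v‖ ^ (-a)) v with hJ₀
  set Nf : ℝ := ∫ p : EuclideanSpace ℝ (Fin 3), |f p| with hNf
  set Ng : ℝ := ∫ p : EuclideanSpace ℝ (Fin 3), |g p| with hNg
  -- the bound `A t`
  set A : ℝ → ℝ := fun t => M * (t / 2) ^ (-(2 * Δ)) * (Nf * Ng) + C * Bf * Bg * (1 + t / 2)⁻¹ * J₀ with hA
  have hAlim : Tendsto A atTop (𝓝 0) := by
    have h1 : Tendsto (fun t : ℝ => (t / 2) ^ (-(2 * Δ))) atTop (𝓝 0) :=
      (tendsto_rpow_neg_atTop (by linarith)).comp (tendsto_id.atTop_div_const (by norm_num))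
    have h2 : Tendsto (fun t : ℝ => (1 + t / 2)⁻¹) atTop (𝓝 0) :=
      tendsto_inv_atTop_zero.comp (tendsto_atTop_add_const_left _ 1
        (tendsto_id.atTop_div_const (by norm_num)))
    have := ((h1.const_mul M).mul_const (Nf * Ng)).add ((h2.const_mul (C * Bf * Bg)).mul_const J₀)
    simpa [hA] using this
  -- the key estimate for `t > 0`
  have hkey : ∀ t : ℝ, 0 < t →
      ‖genFunctional μ (f + timeShiftTest 3 t g) - genFunctional μ f * genFunctional μ g‖ ≤ 4 * A t := by
    intro t ht
    set e : EuclideanSpace ℝ (Fin 3) := EuclideanSpace.single 0 t with he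
    have hcov := norm_genFunctional_add_sub_mul_le_limit hlim hnd hsc hΔ0 hΔ hν hL hlaw f (timeShiftTest 3 t g)
    rw [htrans t] at hcov
    refine hcov.trans (mul_le_mul_of_nonneg_left ?_ (by norm_num))
    -- `W_t ≤ A t`
    have hWle : ∫ x : Fin 2 → EuclideanSpace ℝ (Fin 3), (|f (x 0)| * |(timeShiftTest 3 t g) (x 1)|) * S 2 x ≤
        ∫ x : Fin 2 → EuclideanSpace ℝ (Fin 3), (M * (t / 2) ^ (-(2 * Δ)) * (|f (x 0)| * |g (x 1 - e)|) +
          (C * Bf * Bg * (1 + t / 2)⁻¹) * (w (x 0) * w (x 1 - e) * max 1 (‖x 1 - x 0‖ ^ (-a)))) := by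
      refine integral_mono_of_nonneg ?_ ?_ ?_
      · filter_upwards [ae_mem_nonCoincident 2] with x hx
        exact mul_nonneg (mul_nonneg (abs_nonneg _) (abs_nonneg _)) (hK x hx).1
      · exact ((integrable_abs_mul_abs_shift f.integrable g.integrable e).const_mul _).add
          ((integrable_weight_shift_kernel ha0 ha3 e).const_mul _)
      · -- the pointwise split according to `‖x₁ - x₀‖ ≷ t/2`
        filter_upwards [ae_mem_nonCoincident 2] with x hx
        rw [timeShiftTest_apply]
        have hS0 := (hK x hx).1
        have hw0 : ∀ p, 0 ≤ w p := fun p => weight_nonneg 4 p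
        have hT1 : 0 ≤ M * (t / 2) ^ (-(2 * Δ)) * (|f (x 0)| * |g (x 1 - e)|) := by positivity
        have hT2 : 0 ≤ (C * Bf * Bg * (1 + t / 2)⁻¹) * (w (x 0) * w (x 1 - e) * max 1 (‖x 1 - x 0‖ ^ (-a))) :=
          mul_nonneg (by positivity) (mul_nonneg (mul_nonneg (hw0 _) (hw0 _)) (le_trans zero_le_one (le_max_left _ _)))
        rcases le_or_gt (t / 2) ‖x 1 - x 0‖ with hfar | hnear
        · -- far: `S₂ ≤ M (t/2)^{-2Δ}`
          have hS : S 2 x ≤ M * (t / 2) ^ (-(2 * Δ)) :=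
            (hM x hx).trans (mul_le_mul_of_nonneg_left
              (Real.rpow_le_rpow_of_nonpos (by positivity) hfar (by linarith)) hM0)
          calc |f (x 0)| * |g (x 1 - e)| * S 2 x ≤ |f (x 0)| * |g (x 1 - e)| * (M * (t / 2) ^ (-(2 * Δ))) :=
                mul_le_mul_of_nonneg_left hS (mul_nonneg (abs_nonneg _) (abs_nonneg _))
            _ = M * (t / 2) ^ (-(2 * Δ)) * (|f (x 0)| * |g (x 1 - e)|) := by ring
            _ ≤ _ := le_add_of_nonneg_right hT2
        · -- near: the kernel bound and the decay of `f, g` far out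
          have hS : S 2 x ≤ C * max 1 (‖x 1 - x 0‖ ^ (-a)) := by
            rw [norm_sub_rev]; exact (hK x hx).2
          have hsum : t / 2 < ‖x 0‖ + ‖x 1 - e‖ := norm_add_norm_sub_of_lt ht hnear
          have hfg : |f (x 0)| * |g (x 1 - e)| ≤ Bf * Bg * (1 + t / 2)⁻¹ * (w (x 0) * w (x 1 - e)) := by
            have h1 := abs_le_seminorm_mul_weight_five f (x 0)
            have h2 := abs_le_seminorm_mul_weight_five g (x 1 - e)
            have h5 := weight_five_mul_le (x 0) (x 1 - e)
            have hinv : (1 + (‖x 0‖ + ‖x 1 - e‖))⁻¹ ≤ (1 + t / 2)⁻¹ :=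
              inv_anti₀ (by positivity) (by linarith)
            calc |f (x 0)| * |g (x 1 - e)| ≤ (Bf * (1 + ‖x 0‖) ^ (-(5 : ℝ))) * (Bg * (1 + ‖x 1 - e‖) ^ (-(5 : ℝ))) :=
                  mul_le_mul h1 h2 (abs_nonneg _) (by positivity)
              _ = Bf * Bg * ((1 + ‖x 0‖) ^ (-(5 : ℝ)) * (1 + ‖x 1 - e‖) ^ (-(5 : ℝ))) := by ring
              _ ≤ Bf * Bg * ((1 + (‖x 0‖ + ‖x 1 - e‖))⁻¹ * (w (x 0) * w (x 1 - e))) :=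
                  mul_le_mul_of_nonneg_left h5 (by positivity)
              _ ≤ Bf * Bg * ((1 + t / 2)⁻¹ * (w (x 0) * w (x 1 - e))) := by
                  refine mul_le_mul_of_nonneg_left (mul_le_mul_of_nonneg_right hinv
                    (mul_nonneg (hw0 _) (hw0 _))) (by positivity)
              _ = _ := by ring
          calc |f (x 0)| * |g (x 1 - e)| * S 2 x
              ≤ (Bf * Bg * (1 + t / 2)⁻¹ * (w (x 0) * w (x 1 - e))) * (C * max 1 (‖x 1 - x 0‖ ^ (-a))) :=
                mul_le_mul hfg hS hS0 (by positivity)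
            _ = (C * Bf * Bg * (1 + t / 2)⁻¹) * (w (x 0) * w (x 1 - e) * max 1 (‖x 1 - x 0‖ ^ (-a))) := by ring
            _ ≤ _ := le_add_of_nonneg_left hT1
    refine hWle.trans ?_
    have hI1 := integral_abs_mul_abs_shift (⇑f) (⇑g) e
    have hI2 := integral_weight_shift_kernel_le ha0 ha3 e
    rw [integral_add ((integrable_abs_mul_abs_shift f.integrable g.integrable e).const_mul _)
      ((integrable_weight_shift_kernel ha0 ha3 e).const_mul _), integral_const_mul, integral_const_mul, hI1]
    rw [hA]
    exact add_le_add le_rfl (mul_le_mul_of_nonneg_left hI2 (by positivity))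
  -- conclusion: squeeze
  rw [tendsto_iff_norm_sub_tendsto_zero]
  refine squeeze_zero_norm' ?_ (by simpa using hAlim.const_mul 4)
  filter_upwards [eventually_gt_atTop (0 : ℝ)] with t ht
  rw [norm_norm]
  exact hkey t ht

/-! ### OS3 for the continuum law -/

omit [IsProbabilityMeasure μ] in
/-- **OS3 — reflection positivity of the continuum law**: the lattice inequality
`genFunctional_spinFieldLaw_reflectionPositive` passes to the limit in law.
[cite: GlimmJaffe1987, §6.1] -/
theorem reflectionPositive_limitLaw (hνG : ν ∈ isingGibbsMeasures 3 (criticalBeta 3) 0)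
    (hν : ∀ A : Finset (Site 3), spinCorr ν A = plusCorr 3 (criticalBeta 3) 0 A)
    (hlaw : TendstoInLaw (fun δ => spinFieldLaw ν (box 3 (L δ)) δ (ρ δ)) (𝓝[>] 0) μ)
    {n : ℕ} (c : Fin n → ℂ) (f : Fin n → SchwartzMap (EuclideanSpace ℝ (Fin 3)) ℝ)
    (hf : ∀ i, tsupport ⇑(f i) ⊆ {x : EuclideanSpace ℝ (Fin 3) | 0 < x 0}) :
    0 ≤ (∑ i, ∑ j, (starRingEnd ℂ) (c i) * c j * genFunctional μ (f j - thetaTest 3 (f i))).re ∧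
      (∑ i, ∑ j, (starRingEnd ℂ) (c i) * c j * genFunctional μ (f j - thetaTest 3 (f i))).im = 0 := by
  have hT : Tendsto (fun δ => ∑ i, ∑ j, (starRingEnd ℂ) (c i) * c j *
      genFunctional (spinFieldLaw ν (box 3 (L δ)) δ (ρ δ)) (f j - thetaTest 3 (f i))) (𝓝[>] 0)
      (𝓝 (∑ i, ∑ j, (starRingEnd ℂ) (c i) * c j * genFunctional μ (f j - thetaTest 3 (f i)))) :=
    tendsto_finsetSum _ fun i _ => tendsto_finsetSum _ fun j _ => (hlaw (f j - thetaTest 3 (f i))).const_mul _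
  have hpos : ∀ᶠ δ in 𝓝[>] (0 : ℝ), 0 < δ := eventually_mem_nhdsWithin
  have hRP : ∀ᶠ δ in 𝓝[>] (0 : ℝ),
      0 ≤ (∑ i, ∑ j, (starRingEnd ℂ) (c i) * c j *
        genFunctional (spinFieldLaw ν (box 3 (L δ)) δ (ρ δ)) (f j - thetaTest 3 (f i))).re ∧
      (∑ i, ∑ j, (starRingEnd ℂ) (c i) * c j *
        genFunctional (spinFieldLaw ν (box 3 (L δ)) δ (ρ δ)) (f j - thetaTest 3 (f i))).im = 0 :=
    hpos.mono fun δ hδ => genFunctional_spinFieldLaw_reflectionPositive hνG hν (L δ) hδ (ρ δ) c f hf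
  constructor
  · exact ge_of_tendsto ((continuous_re.tendsto _).comp hT) (hRP.mono fun δ h => h.1)
  · refine tendsto_nhds_unique ((continuous_im.tendsto _).comp hT) ?_
    exact (tendsto_const_nhds (x := (0 : ℝ))).congr' (hRP.mono fun δ h => h.2.symm)

/-! ### The boxes -/

/-- The boxes `box 3 ⌊δ⁻²⌋` exhaust `ℝ³` in continuum units: `δ ⌊δ⁻²⌋ → ∞` as `δ → 0⁺`.
[folklore] -/
theorem tendsto_mesh_mul_boxSide :
    Tendsto (fun δ : ℝ => δ * (⌊δ⁻¹ ^ 2⌋₊ : ℕ)) (𝓝[>] 0) atTop := by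
  have hneg : Tendsto (fun δ : ℝ => -δ) (𝓝[>] 0) (𝓝 (-0)) :=
    (continuous_neg.tendsto (0 : ℝ)).mono_left nhdsWithin_le_nhds
  have h1 : Tendsto (fun δ : ℝ => δ⁻¹ + -δ) (𝓝[>] 0) atTop := tendsto_inv_nhdsGT_zero.atTop_add hneg
  refine tendsto_atTop_mono' _ ?_ h1
  filter_upwards [eventually_mem_nhdsWithin] with δ (hδ : 0 < δ)
  have hfl : δ⁻¹ ^ 2 - 1 < (⌊δ⁻¹ ^ 2⌋₊ : ℕ) := Nat.sub_one_lt_floor _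
  have : δ * (δ⁻¹ ^ 2 - 1) = δ⁻¹ + -δ := by field_simp; ring
  rw [← this]
  exact (mul_le_mul_of_nonneg_left hfl.le hδ.le)

/-! ### The theorem -/

/-- **`FieldRealisation`** (item stmt-CriticalPhenomena-11245 of route MarkovRigidity).
[cite: GlimmJaffe1987, §6.1] -/
theorem fieldRealisation_proof : FieldRealisation := by
  intro ρ Δ S hρ hlim hzero hnd htr hsc
  refine ⟨RotationUpgradeFromTwoPointNegative.continuousOn_of_limit hlim, ?_⟩
  -- the scaling dimension window
  obtain ⟨hΔlo, hΔhi⟩ := HyperoctahedralRPTwoPoint.window hρ hlim hnd hsc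
  have hΔ0 : 0 < Δ := by linarith
  have hΔ : Δ < 3 / 2 := by linarith
  -- the critical DLR state carrying the plus correlations
  obtain ⟨ν, hνG, -, hν⟩ := exists_plusMeasure_holds (d := 3) (β := criticalBeta 3) (h := 0)
    (criticalBeta_nonneg 3)
  haveI : IsProbabilityMeasure ν := ((mem_isingGibbsMeasures_iff 3 _ 0 ν).1 hνG).isProbabilityMeasure
  -- the boxes and the continuum law
  have hL := tendsto_mesh_mul_boxSide
  obtain ⟨μ, hμP, hμC, hlaw⟩ := exists_limitLaw (L := fun δ : ℝ => ⌊δ⁻¹ ^ 2⌋₊) hlim hnd hsc hΔ0 hΔ hν hL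
  haveI := hμP
  refine ⟨μ, hμP, hasAllMoments_limitLaw hlim hnd hsc hΔ0 hΔ hν hL hlaw,
    fun f => integrable_exp_eval_limitLaw hlim hnd hsc hΔ0 hΔ hν hL hlaw f,
    fun n f => by
      rw [moment_limitLaw_eq hlim hnd hsc hΔ0 hΔ hν hL hlaw f]
      exact integral_congr_ae (Eventually.of_forall fun x => mul_comm _ _),
    isTranslationInvariantLaw_of hμC htr,
    fun s hs => map_act_scale_eq_self hμC hsc s hs,
    isTimeReflectionInvariantLaw_of hμC hlim hzero,
    fun n c f hf => reflectionPositive_limitLaw hνG hν hlaw c f hf,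
    fun f g => tendsto_genFunctional_timeShift hlim hnd hsc htr hΔ0 hΔ hν hL hlaw hμC f g⟩

end Summit.CriticalPhenomena.Ising3DConformalLimit.MarkovRigidityFieldRealisation

end
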